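import Summits.Ventures.HodgeRepro2.ReflexSignature
import Summits.Ventures.HodgeRepro2.FixedFieldAut

/-!
# ReflexSignatureComplex — Liu's Definition C.1 over `Gal(ℂ/ℚ)` itself (T4-B2 B2.4(a), (c), (e))

`ReflexSignature.lean` computes the reflex field of Liu's Definition C.1 (the fixed field of the
stabiliser of the signature element `sig`, resp. `sig′`, under the Galois action on the complex
embeddings) in a finite Galois model `Gal(L/K)` standing in for `Gal(ℂ/ℚ)`.  This file does the
computation for `Gal(ℂ/ℚ) = ℂ ≃ₐ[ℚ] ℂ` ITSELF acting on `F →ₐ[ℚ] ℂ` by post-composition (the scoped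
instance `ReflexSignature.galEmbAction` with `L = ℂ`, i.e. Liu p. 107 l. 16 as printed), so that
`ReflexSignature.reflexFieldOfSig ℚ ℂ n : IntermediateField ℚ ℂ` is literally Liu's Definition C.1:

* `fixedField_stabilizer_eq_fieldRange`: the fixed field of the stabiliser of an embedding `τ₁` is
  exactly its image `τ₁(F)` — the stabiliser is `Aut(ℂ/τ₁(F))` and `Fix(Aut(ℂ/k)) = k`
  (`FixedFieldAut.exists_algEquiv_ne`, T4-B2 B2.4(b)); no finiteness or normality hypothesis.
* `reflexFieldOfSig_reducedSig_eq_fieldRange`: the reduced reflex field of the `τ₁`-nearby signature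
  `sig′ = 1·τ₁` is `τ₁(F)` (T4-B2 B2.4(a)+(c); Liu Rem. C.2 «the reflex field of `h_{V,τ′}` is `τ′(E)`»).
* `reflexFieldOfSig_nearbyFullSig_eq_fieldRange`: the (non-reduced) reflex field of the `τ₁`-nearby
  signature `sig = (n−1)·τ̄₁ + 1·τ₁ + n·(Φᶜ ∖ {τ̄₁})` is again `τ₁(F)` when all embeddings of `F` have
  the same image (`fieldRange_eq_of_normal`: `F/ℚ` normal, e.g. Galois) and `n ≠ 1, 2` (T4-B2 B2.4(e)).

Everything is over `ℚ` and `ℂ`; no Shimura datum is modelled — the printed identification of this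
combinatorial field with the reflex field of the Shimura datum (Liu p. 108 ll. 28–29) stays a
displayed printed statement (route/T6-B2-HANDOFF-p4.md §3 D1/D2).
-/

namespace Summit.Ventures.HodgeRepro2.ReflexSignatureComplex

open ReflexSignature FixedFieldAut IntermediateField

variable {F : Type*} [Field F] [Algebra ℚ F]

/-- `σ ∈ Gal(ℂ/ℚ)` stabilises the embedding `τ₁` (under post-composition) iff it fixes `τ₁(x)` for
every `x : F`. -/
theorem mem_stabilizer_iff_forall (τ₁ : F →ₐ[ℚ] ℂ) (σ : Gal(ℂ/ℚ)) :
    σ ∈ MulAction.stabilizer Gal(ℂ/ℚ) τ₁ ↔ ∀ x : F, σ (τ₁ x) = τ₁ x := by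
  rw [MulAction.mem_stabilizer_iff]
  constructor
  · intro h x
    have hx := congrArg (fun τ : F →ₐ[ℚ] ℂ => τ x) h
    simpa [smul_emb_apply] using hx
  · intro h
    ext x
    rw [smul_emb_apply]
    exact h x

/-- `σ ∈ Gal(ℂ/ℚ)` stabilises `τ₁` iff it fixes the subfield `τ₁(F) ⊂ ℂ` pointwise: the stabiliser of
`τ₁` is `Aut(ℂ/τ₁(F))` (T4-B2 B2.4(a)). -/
theorem mem_stabilizer_iff_forall_mem_fieldRange (τ₁ : F →ₐ[ℚ] ℂ) (σ : Gal(ℂ/ℚ)) :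
    σ ∈ MulAction.stabilizer Gal(ℂ/ℚ) τ₁ ↔ ∀ y ∈ τ₁.fieldRange, σ y = y := by
  rw [mem_stabilizer_iff_forall]
  constructor
  · rintro h y ⟨x, rfl⟩
    exact h x
  · intro h x
    exact h _ ⟨x, rfl⟩

/-- The easy inclusion: `τ₁(F)` is fixed by the stabiliser of `τ₁`. -/
theorem fieldRange_le_fixedField_stabilizer (τ₁ : F →ₐ[ℚ] ℂ) :
    τ₁.fieldRange ≤ fixedField (MulAction.stabilizer Gal(ℂ/ℚ) τ₁) := by
  intro y hy
  rw [mem_fixedField_iff]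
  intro σ hσ
  exact (mem_stabilizer_iff_forall_mem_fieldRange τ₁ σ).1 hσ y hy

/-- `Fix(Aut(ℂ/k)) = k`, in the form needed here: if `x ∈ ℂ` is fixed by every `ℚ`-automorphism of
`ℂ` that fixes the intermediate field `k` pointwise, then `x ∈ k`.  Bridge from
`FixedFieldAut.exists_algEquiv_ne` (stated for `Gal(ℂ/k)`) to `Gal(ℂ/ℚ)` via `AlgEquiv.restrictScalars`. -/
theorem mem_of_forall_algEquiv_fix (k : IntermediateField ℚ ℂ) (x : ℂ)
    (hx : ∀ σ : Gal(ℂ/ℚ), (∀ y ∈ k, σ y = y) → σ x = x) : x ∈ k := by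
  by_contra hxk
  have hx' : x ∉ Set.range (algebraMap k ℂ) := by
    rintro ⟨⟨y, hy⟩, rfl⟩
    exact hxk hy
  obtain ⟨σ, hσ⟩ := FixedFieldAut.exists_algEquiv_ne (K := k) (L := ℂ) x hx'
  apply hσ
  have hfix : ∀ y ∈ k, (σ.restrictScalars ℚ) y = y := by
    intro y hy
    have hc := σ.commutes ⟨y, hy⟩
    simpa using hc
  simpa using hx (σ.restrictScalars ℚ) hfix

/-- **The fixed field of the stabiliser of `τ₁` is `τ₁(F)`** (Liu Def. C.1 for the element `1·τ₁` of
`ℕ[Φ_E]`, over `Gal(ℂ/ℚ)` itself): `Fix(Aut(ℂ/τ₁(F))) = τ₁(F)` — T4-B2 B2.4(a)–(c). No finiteness,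
separability or normality hypothesis on `F/ℚ`. -/
theorem fixedField_stabilizer_eq_fieldRange (τ₁ : F →ₐ[ℚ] ℂ) :
    fixedField (MulAction.stabilizer Gal(ℂ/ℚ) τ₁) = τ₁.fieldRange := by
  refine le_antisymm ?_ (fieldRange_le_fixedField_stabilizer τ₁)
  intro x hx
  rw [mem_fixedField_iff] at hx
  exact mem_of_forall_algEquiv_fix τ₁.fieldRange x
    (fun σ hσ => hx σ ((mem_stabilizer_iff_forall_mem_fieldRange τ₁ σ).2 hσ))

/-- **Liu Def. C.1 for the reduced signature, over `Gal(ℂ/ℚ)`**: the reduced reflex field of the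
`τ₁`-nearby datum (`sig′_{V(τ),Φ} = 1·τ₁`, Liu (C.1) with signature `(n−1, 1)` at `τ` and `(n, 0)`
elsewhere) is `τ₁(F) ⊂ ℂ` — Liu Rem. C.2 «the reflex field of `h_{V,τ′}` is `τ′(E)`» (T4-B2 B2.4(c)),
for EVERY field `F ⊇ ℚ` and every embedding `τ₁`. -/
theorem reflexFieldOfSig_reducedSig_eq_fieldRange [DecidableEq (F →ₐ[ℚ] ℂ)] (τ₁ : F →ₐ[ℚ] ℂ) :
    reflexFieldOfSig ℚ ℂ (reducedSig τ₁) = τ₁.fieldRange := by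
  unfold reflexFieldOfSig
  rw [sigStabilizer_reducedSig]
  exact fixedField_stabilizer_eq_fieldRange τ₁

/-- If every embedding `τ' : F → ℂ` has the same image as `τ₁`, then `Aut(ℂ/τ₁(F))` fixes every
embedding, hence stabilises every signature element `n ∈ ℕ[Φ_E]`. -/
theorem stabilizer_le_sigStabilizer_of_forall_fieldRange_eq (τ₁ : F →ₐ[ℚ] ℂ)
    (h : ∀ τ' : F →ₐ[ℚ] ℂ, τ'.fieldRange = τ₁.fieldRange) (n : (F →ₐ[ℚ] ℂ) → ℕ) :
    MulAction.stabilizer Gal(ℂ/ℚ) τ₁ ≤ sigStabilizer Gal(ℂ/ℚ) n := by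
  intro σ hσ
  rw [mem_sigStabilizer_iff]
  intro τ'
  have hτ' : σ • τ' = τ' := by
    rw [← MulAction.mem_stabilizer_iff, mem_stabilizer_iff_forall_mem_fieldRange, h τ']
    exact (mem_stabilizer_iff_forall_mem_fieldRange τ₁ σ).1 hσ
  rw [hτ']

/-- Under the equal-image hypothesis, the stabiliser of the `τ₁`-nearby full signature
`sig = (n−1)·τ̄₁ + 1·τ₁ + n·(Φᶜ ∖ {τ̄₁})` (`n ≠ 1, 2`, `τ₁ ∈ Φ`) is exactly the stabiliser of `τ₁`
(T4-B2 B2.4(e): `⊆` because the coefficient `1` occurs at `τ₁` only, `⊇` because `Aut(ℂ/τ₁(F))` fixes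
every embedding). -/
theorem sigStabilizer_nearbyFullSig_eq [DecidableEq (F →ₐ[ℚ] ℂ)] (Φ : Set (F →ₐ[ℚ] ℂ))
    [DecidablePred (· ∈ Φ)] (τ₁ τ₁bar : F →ₐ[ℚ] ℂ) (n : ℕ)
    (h : ∀ τ' : F →ₐ[ℚ] ℂ, τ'.fieldRange = τ₁.fieldRange) (hΦ : τ₁ ∈ Φ) (hn1 : n ≠ 1) (hn2 : n ≠ 2) :
    sigStabilizer Gal(ℂ/ℚ) (nearbyFullSig Φ τ₁ τ₁bar n) = MulAction.stabilizer Gal(ℂ/ℚ) τ₁ :=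
  le_antisymm (sigStabilizer_nearbyFullSig_le _ Φ τ₁ τ₁bar n hΦ hn1 hn2)
    (stabilizer_le_sigStabilizer_of_forall_fieldRange_eq τ₁ h _)

/-- **Liu Def. C.1 for the full signature, over `Gal(ℂ/ℚ)`**: the (non-reduced) reflex field of the
`τ₁`-nearby datum is `τ₁(F)` as well, provided all embeddings of `F` have the same image (`F/ℚ`
normal: `fieldRange_eq_of_normal`), `τ₁ ∈ Φ` and `n ≠ 1, 2` — T4-B2 B2.4(e) with `Aut(ℂ)` itself. -/
theorem reflexFieldOfSig_nearbyFullSig_eq_fieldRange [DecidableEq (F →ₐ[ℚ] ℂ)]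
    (Φ : Set (F →ₐ[ℚ] ℂ)) [DecidablePred (· ∈ Φ)] (τ₁ τ₁bar : F →ₐ[ℚ] ℂ) (n : ℕ)
    (h : ∀ τ' : F →ₐ[ℚ] ℂ, τ'.fieldRange = τ₁.fieldRange) (hΦ : τ₁ ∈ Φ) (hn1 : n ≠ 1) (hn2 : n ≠ 2) :
    reflexFieldOfSig ℚ ℂ (nearbyFullSig Φ τ₁ τ₁bar n) = τ₁.fieldRange := by
  unfold reflexFieldOfSig
  rw [sigStabilizer_nearbyFullSig_eq Φ τ₁ τ₁bar n h hΦ hn1 hn2]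
  exact fixedField_stabilizer_eq_fieldRange τ₁

/-- For `F/ℚ` normal, all `ℚ`-embeddings `F → ℂ` have the same image (transport of
`AlgHom.fieldRange_of_normal` along `AlgEquiv.ofInjectiveField`). -/
theorem fieldRange_eq_of_normal [Normal ℚ F] (τ τ' : F →ₐ[ℚ] ℂ) : τ'.fieldRange = τ.fieldRange := by
  have hN : Normal ℚ (↥τ.fieldRange) := Normal.of_algEquiv (AlgEquiv.ofInjectiveField τ)
  let e : F ≃ₐ[ℚ] τ.fieldRange := AlgEquiv.ofInjectiveField τ
  have h1 : (τ'.comp (e.symm : τ.fieldRange →ₐ[ℚ] F)).fieldRange = τ.fieldRange :=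
    @AlgHom.fieldRange_of_normal ℚ ℂ _ _ _ τ.fieldRange hN _
  have h2 : (τ'.comp (e.symm : τ.fieldRange →ₐ[ℚ] F)).fieldRange = τ'.fieldRange := by
    ext y
    simp only [AlgHom.mem_fieldRange, AlgHom.comp_apply]
    constructor
    · rintro ⟨x, rfl⟩
      exact ⟨_, rfl⟩
    · rintro ⟨x, rfl⟩
      exact ⟨e x, by simp⟩
  rw [← h2, h1]

/-- The Galois case of the brief (T4-B2 B2.4(c), (e); `F` Galois over `ℚ`): both reflex fields of
the `τ₁`-nearby datum are `τ₁(F)`, over `Gal(ℂ/ℚ)` itself. -/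
theorem reflexFieldOfSig_eq_fieldRange_of_isGalois [IsGalois ℚ F] [DecidableEq (F →ₐ[ℚ] ℂ)]
    (Φ : Set (F →ₐ[ℚ] ℂ)) [DecidablePred (· ∈ Φ)] (τ₁ τ₁bar : F →ₐ[ℚ] ℂ) (n : ℕ)
    (hΦ : τ₁ ∈ Φ) (hn1 : n ≠ 1) (hn2 : n ≠ 2) :
    reflexFieldOfSig ℚ ℂ (reducedSig τ₁) = τ₁.fieldRange ∧
      reflexFieldOfSig ℚ ℂ (nearbyFullSig Φ τ₁ τ₁bar n) = τ₁.fieldRange :=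
  ⟨reflexFieldOfSig_reducedSig_eq_fieldRange τ₁,
    reflexFieldOfSig_nearbyFullSig_eq_fieldRange Φ τ₁ τ₁bar n
      (fun τ' => fieldRange_eq_of_normal τ₁ τ') hΦ hn1 hn2⟩

/-- The reflex field `τ₁(F) ⊂ ℂ` has the same `ℚ`-dimension as `F` (for the instantiation: a sextic
field, `[τ₁(F) : ℚ] = 6`). -/
theorem finrank_fieldRange (τ₁ : F →ₐ[ℚ] ℂ) :
    Module.finrank ℚ τ₁.fieldRange = Module.finrank ℚ F :=
  ((AlgEquiv.ofInjectiveField τ₁).symm.toLinearEquiv.finrank_eq)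

end Summit.Ventures.HodgeRepro2.ReflexSignatureComplex
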